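import Summits.ABC.StewartYu.GenThreeFrameSpecTwo
import Mathlib.Algebra.Polynomial.HasseDeriv
import Mathlib.Algebra.Polynomial.Degree.Support
import Mathlib.Algebra.Polynomial.BigOperators
import HarnessLib

/-!
# Cell abc-stewartyu, Gen-3 frame at `p = 2` (crux `Y07Two`, stmt-ABC-19659): the END-INPUT BRIDGE — from the
# frame's native last-level identities (any polynomial basis in `Y₀`, Hasse weights) to `FrameOutputTwo`

`Summits/ABC/StewartYu/GenThreeEndBridgeTwo.lean` — cell `abc-stewartyu` (HOME `run/shared/lean/pub/abc-stewartyu/`),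
route `PadicPrimesKummerThird`, seat p3 (g5), F-two LEAD of the crux `Y07Two`.  Theorems only, place-free
algebra over `ℚ` (the `p = 2` in the name is the consumer, `GenThreeFrameSpecTwo.FrameOutputTwo`).

The analytic frame (Yu 2013 §4–§5 / Nesterenko 2003 §3–§5) does not carry its auxiliary polynomial in the
monomial basis `Y₀^a`: the `Y₀`-factor attached to an unknown `i` is a polynomial `Rᵢ(Y₀)` of degree
`≤ D₀` chosen for integrality and size (Nesterenko's `Δ(Y₀; ℓ₀, H)`, Yu's `Δ(Y₀ + λ₋₁; D₋₁+1)^{λ₀+1}`), the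
`Y₀`-derivatives are HASSE derivatives `(1/t!)(d/dY₀)ᵗ`, and the unknowns are indexed by the frame's own
finite type (several unknowns may share the exponent vector `κ`).  At the last level the frame proves, for
`|x| ≤ (n+1)X`, `t + ∑ νₖ ≤ (n+1)S₀`, `ν_{j₀} = 0`:

  `∑_{i ∈ I} pᵢ · (Hasse_t Rᵢ)(x) · ∏ₖ (b_{j₀} κᵢₖ − bₖ κᵢ_{j₀})^{νₖ} · ∏ⱼ αⱼ^{x κᵢⱼ} = 0`   (in `ℚ`).

`frameOutputTwo_of_hasseIdentities` converts exactly this into `FrameOutputTwo n α b j₀ D₀ S₀ X D`: the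
presentation `q(a, κ) = ∑_{i : κᵢ = κ} pᵢ · coeff_a(Rᵢ)` on `range(D₀+1) × κ(I)`, the identity
`∑_a coeff_a(R)·a^{(t)}·x^{a−t} = t!·(Hasse_t R)(x)` (`sum_coeff_descFactorial_eq`), and nonvanishing from ONE
fibre `∑_{κᵢ = κ₀} pᵢ Rᵢ ≠ 0` (immediate for a degree-triangular basis and `p ≠ 0`).  The directional moments
are taken in POWER form here; a frame working with Fel'dman's binomial moments `Δ(γ; ν)` or with recentred /
rescaled scalars converts first by `DirWeights.dirDelta_sums_iff` (p2-g4) and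
`DirectionalRecombination.sum_mul_prod_affine_pow_eq_zero_of_total` (p3-g4).

WHAT THIS IS NOT: no analytic content; no crux moves.

References: Yu. V. Nesterenko, LNM 1819 (2003), §5.1 (5.1)–(5.4); K. Yu, Acta Math. 211 (2013), (4.22)–(4.25),
(5.4).
-/

noncomputable section

open Finset Polynomial
open scoped Nat

namespace Summit.ABC.StewartYu.GenThreeEndBridgeTwo

open Summit.ABC.StewartYu.GenThreeFrameSpecTwo

variable {n : ℕ}

/-! ### Hasse derivatives against the monomial presentation -/

/-- `(Hasse_t R)(x) = ∑_{a < N} C(a,t)·coeff_a(R)·x^{a−t}` for `natDegree R < N`. [folklore] -/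
theorem eval_hasseDeriv_eq_sum_range {K : Type*} [Field K] (R : K[X]) {N : ℕ} (hR : R.natDegree < N)
    (t : ℕ) (x : K) :
    (hasseDeriv t R).eval x = ∑ a ∈ Finset.range N, ((a.choose t : ℕ) : K) * R.coeff a * x ^ (a - t) := by
  classical
  rw [hasseDeriv_apply, Polynomial.sum_def, Polynomial.eval_finsetSum]
  simp only [eval_monomial]
  rw [← Finset.sum_subset (Polynomial.supp_subset_range hR)]
  · intro a _ ha
    rw [Polynomial.notMem_support_iff.mp ha]
    ring

/-- **Monomial/`descFactorial` form vs Hasse form**: `∑_{a < N} coeff_a(R)·a^{(t)}·x^{a−t} = t!·(Hasse_t R)(x)`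
for `natDegree R < N` (`a^{(t)} = t!·C(a,t)`). [folklore] -/
theorem sum_coeff_descFactorial_eq {K : Type*} [Field K] (R : K[X]) {N : ℕ} (hR : R.natDegree < N)
    (t : ℕ) (x : K) :
    ∑ a ∈ Finset.range N, R.coeff a * ((a.descFactorial t : ℕ) : K) * x ^ (a - t) =
      ((t ! : ℕ) : K) * (hasseDeriv t R).eval x := by
  rw [eval_hasseDeriv_eq_sum_range R hR t x, Finset.mul_sum]
  refine Finset.sum_congr rfl fun a _ => ?_
  rw [Nat.descFactorial_eq_factorial_mul_choose]
  push_cast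
  ring

/-! ### The bridge -/

/-- **END-INPUT BRIDGE.**  Native last-level identities of the frame — unknowns `i ∈ I` with `Y₀`-factors
`Rᵢ ∈ ℚ[Y₀]` of degree `≤ D₀`, exponents `κᵢ` with `|κᵢⱼ| ≤ Dⱼ`, coefficients `pᵢ`, Hasse weights in `Y₀`
and power moments of the directional scalars `b_{j₀}κᵢₖ − bₖκᵢ_{j₀}`, vanishing at the points `(x, αˣ)` for
`|x| ≤ (n+1)X`, `t + ∑ νₖ ≤ (n+1)S₀`, `ν_{j₀} = 0` — together with ONE nonzero fibre `∑_{κᵢ = κ₀} pᵢ Rᵢ ≠ 0`,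
give `FrameOutputTwo n α b j₀ D₀ S₀ X D` (the `hL` input of the zero estimate's END).
[cite: Nesterenko2003, §5.1 (5.1)–(5.4)] -/
theorem frameOutputTwo_of_hasseIdentities {ι : Type*} (I : Finset ι) (R : ι → ℚ[X]) (κ : ι → Fin n → ℤ)
    (p : ι → ℚ) (α : Fin n → ℚ) (b : Fin n → ℤ) (j₀ : Fin n) (D₀ S₀ X : ℕ) (D : Fin n → ℕ)
    (hR : ∀ i ∈ I, (R i).natDegree ≤ D₀) (hκ : ∀ i ∈ I, ∀ j, |κ i j| ≤ (D j : ℤ))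
    (hne : ∃ κ₀, ∑ i ∈ I.filter (fun i => κ i = κ₀), p i • R i ≠ 0)
    (hN : ∀ x : ℤ, |x| ≤ (((n + 1) * X : ℕ) : ℤ) → ∀ (t : ℕ) (ν : Fin n → ℕ), ν j₀ = 0 →
      t + ∑ k, ν k ≤ (n + 1) * S₀ →
      ∑ i ∈ I, p i * (hasseDeriv t (R i)).eval (x : ℚ) *
        (∏ k, ((b j₀ * κ i k - b k * κ i j₀ : ℤ) : ℚ) ^ ν k) * ∏ j, α j ^ (x * κ i j) = 0) :
    FrameOutputTwo n α b j₀ D₀ S₀ X D := by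
  classical
  -- the monomial presentation
  set I' : Finset (ℕ × (Fin n → ℤ)) := (Finset.range (D₀ + 1)) ×ˢ (I.image κ) with hI'
  set qQ : ℕ × (Fin n → ℤ) → ℚ :=
    fun ak => ∑ i ∈ I.filter (fun i => κ i = ak.2), p i * (R i).coeff ak.1 with hqQ
  set q : ℕ × (Fin n → ℤ) → ℂ := fun ak => ((qQ ak : ℚ) : ℂ) with hq
  -- the nonzero fibre
  obtain ⟨κ₀, hκ₀⟩ := hne
  set Q₀ : ℚ[X] := ∑ i ∈ I.filter (fun i => κ i = κ₀), p i • R i with hQ₀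
  have hQ₀deg : Q₀.natDegree ≤ D₀ := by
    rw [hQ₀]
    refine Polynomial.natDegree_sum_le_of_forall_le (s := I.filter (fun i => κ i = κ₀))
      (fun i => p i • R i) fun i hi => ?_
    exact (Polynomial.natDegree_smul_le _ _).trans (hR i (Finset.mem_filter.mp hi).1)
  set a₀ : ℕ := Q₀.natDegree with ha₀
  have hQa₀ : Q₀.coeff a₀ ≠ 0 := by
    rw [ha₀, Polynomial.coeff_natDegree]; exact Polynomial.leadingCoeff_ne_zero.mpr hκ₀
  have hcoeff : ∀ a, Q₀.coeff a = qQ (a, κ₀) := by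
    intro a
    rw [hQ₀, Polynomial.finsetSum_coeff]
    refine Finset.sum_congr rfl fun i _ => ?_
    rw [Polynomial.coeff_smul, smul_eq_mul]
  -- `κ₀` is attained on `I`
  have hκ₀I : κ₀ ∈ I.image κ := by
    have hnonempty : (I.filter (fun i => κ i = κ₀)).Nonempty := by
      by_contra hempty
      rw [Finset.not_nonempty_iff_eq_empty] at hempty
      apply hκ₀; rw [hQ₀, hempty, Finset.sum_empty]
    obtain ⟨i, hi⟩ := hnonempty
    rw [Finset.mem_filter] at hi
    exact Finset.mem_image.mpr ⟨i, hi.1, hi.2⟩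
  refine ⟨I', q, (a₀, κ₀), ?_, ?_, ?_, ?_, ?_⟩
  · -- `a ≤ D₀`
    intro ak hak
    rw [hI', Finset.mem_product, Finset.mem_range] at hak
    omega
  · -- `|κ j| ≤ D j`
    intro ak hak j
    rw [hI', Finset.mem_product, Finset.mem_image] at hak
    obtain ⟨i, hi, hik⟩ := hak.2
    rw [← hik]; exact hκ i hi j
  · -- `(a₀, κ₀) ∈ I'`
    rw [hI', Finset.mem_product, Finset.mem_range]
    exact ⟨by omega, hκ₀I⟩
  · -- `q (a₀, κ₀) ≠ 0`
    rw [hq]; dsimp only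
    rw [← hcoeff a₀]
    exact_mod_cast hQa₀
  · -- the identities
    intro x hx t ν hν hT
    have hid := hN x hx t ν hν hT
    -- abbreviations for the `κ`-dependent factors (over `ℂ`)
    set F : (Fin n → ℤ) → ℂ := fun κ' =>
      (∏ k, ((b j₀ : ℂ) * (κ' k : ℂ) - (b k : ℂ) * (κ' j₀ : ℂ)) ^ ν k) *
        ∏ j, ((α j : ℂ)) ^ (x * κ' j) with hF
    -- Step 1: rewrite the presented sum as a double sum over `range (D₀+1) × image κ`
    have hstep1 : ∑ ak ∈ I', q ak * (((ak.1).descFactorial t : ℕ) : ℂ) * ((x : ℂ) * 1) ^ (ak.1 - t) *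
          (∏ k, ((b j₀ : ℂ) * (ak.2 k : ℂ) - (b k : ℂ) * (ak.2 j₀ : ℂ)) ^ ν k) *
          ∏ j, ((α j : ℂ)) ^ (x * ak.2 j) =
        ∑ κ' ∈ I.image κ, F κ' * ∑ a ∈ Finset.range (D₀ + 1),
          q (a, κ') * (((a.descFactorial t : ℕ) : ℂ)) * (x : ℂ) ^ (a - t) := by
      rw [hI', Finset.sum_product_right]
      refine Finset.sum_congr rfl fun κ' _ => ?_
      rw [Finset.mul_sum]
      refine Finset.sum_congr rfl fun a _ => ?_
      rw [mul_one, hF]; ring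
    -- Step 2: each inner sum is `t! · ∑_{i : κ i = κ'} p i · Hasse_t(R i)(x)` (cast)
    have hstep2 : ∀ κ' ∈ I.image κ,
        ∑ a ∈ Finset.range (D₀ + 1), q (a, κ') * (((a.descFactorial t : ℕ) : ℂ)) * (x : ℂ) ^ (a - t) =
          (((t ! : ℕ) : ℚ) * ∑ i ∈ I.filter (fun i => κ i = κ'),
              p i * (hasseDeriv t (R i)).eval (x : ℚ) : ℚ) := by
      intro κ' _
      have hdeg : ∀ i ∈ I.filter (fun i => κ i = κ'), (R i).natDegree < D₀ + 1 := fun i hi =>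
        Nat.lt_succ_of_le (hR i (Finset.mem_filter.mp hi).1)
      -- over `ℚ` first
      have hQ : ∑ a ∈ Finset.range (D₀ + 1), qQ (a, κ') * ((a.descFactorial t : ℕ) : ℚ) * (x : ℚ) ^ (a - t) =
          ((t ! : ℕ) : ℚ) * ∑ i ∈ I.filter (fun i => κ i = κ'), p i * (hasseDeriv t (R i)).eval (x : ℚ) := by
        calc ∑ a ∈ Finset.range (D₀ + 1), qQ (a, κ') * ((a.descFactorial t : ℕ) : ℚ) * (x : ℚ) ^ (a - t)
            = ∑ a ∈ Finset.range (D₀ + 1), ∑ i ∈ I.filter (fun i => κ i = κ'),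
                p i * ((R i).coeff a * ((a.descFactorial t : ℕ) : ℚ) * (x : ℚ) ^ (a - t)) := by
              refine Finset.sum_congr rfl fun a _ => ?_
              rw [hqQ]; dsimp only
              rw [Finset.sum_mul, Finset.sum_mul]
              refine Finset.sum_congr rfl fun i _ => ?_
              ring
          _ = ∑ i ∈ I.filter (fun i => κ i = κ'), p i *
                ∑ a ∈ Finset.range (D₀ + 1), (R i).coeff a * ((a.descFactorial t : ℕ) : ℚ) * (x : ℚ) ^ (a - t) := by
              rw [Finset.sum_comm]
              refine Finset.sum_congr rfl fun i _ => ?_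
              rw [Finset.mul_sum]
          _ = ∑ i ∈ I.filter (fun i => κ i = κ'), p i * (((t ! : ℕ) : ℚ) * (hasseDeriv t (R i)).eval (x : ℚ)) := by
              refine Finset.sum_congr rfl fun i hi => ?_
              rw [sum_coeff_descFactorial_eq (R i) (hdeg i hi) t (x : ℚ)]
          _ = ((t ! : ℕ) : ℚ) * ∑ i ∈ I.filter (fun i => κ i = κ'), p i * (hasseDeriv t (R i)).eval (x : ℚ) := by
              rw [Finset.mul_sum]
              refine Finset.sum_congr rfl fun i _ => ?_
              ring
      have hcast : ∑ a ∈ Finset.range (D₀ + 1), q (a, κ') * (((a.descFactorial t : ℕ) : ℂ)) * (x : ℂ) ^ (a - t) =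
          ((∑ a ∈ Finset.range (D₀ + 1), qQ (a, κ') * ((a.descFactorial t : ℕ) : ℚ) * (x : ℚ) ^ (a - t) : ℚ) : ℂ) := by
        rw [hq]; push_cast; rfl
      rw [hcast, hQ]
    -- Step 3: the native identity, regrouped by fibres of `κ`, cast to `ℂ`
    have hfib : ∑ κ' ∈ I.image κ, F κ' * (((t ! : ℕ) : ℚ) * ∑ i ∈ I.filter (fun i => κ i = κ'),
          p i * (hasseDeriv t (R i)).eval (x : ℚ) : ℚ) =
        ((t ! : ℕ) : ℂ) * ((∑ i ∈ I, p i * (hasseDeriv t (R i)).eval (x : ℚ) *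
          (∏ k, ((b j₀ * κ i k - b k * κ i j₀ : ℤ) : ℚ) ^ ν k) * ∏ j, α j ^ (x * κ i j) : ℚ) : ℂ) := by
      rw [← Finset.sum_fiberwise_of_maps_to (s := I) (t := I.image κ) (g := κ)
        (fun i hi => Finset.mem_image_of_mem κ hi)]
      push_cast
      rw [Finset.mul_sum]
      refine Finset.sum_congr rfl fun κ' _ => ?_
      rw [Finset.mul_sum, Finset.mul_sum, Finset.mul_sum]
      refine Finset.sum_congr rfl fun i hi => ?_
      have hik : κ i = κ' := (Finset.mem_filter.mp hi).2
      rw [hF, ← hik]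
      ring
    rw [hstep1]
    rw [Finset.sum_congr rfl fun κ' hκ' => by rw [hstep2 κ' hκ']]
    rw [hfib, hid]
    push_cast
    ring

end Summit.ABC.StewartYu.GenThreeEndBridgeTwo

end
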